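import Mathlib
import HarnessLib
import Summits.HubbardSuperconductivity.HubbardSuperconductivity.Theorems.LiebTwinNoOnsiteODLROEtaVacuum
import Summits.HubbardSuperconductivity.HubbardSuperconductivity.Theorems.LiebTwinNoOnsiteODLROSublatticeCharges
import Summits.HubbardSuperconductivity.HubbardSuperconductivity.Theorems.ThermalWedgeTwSeededEnsembleEquivalenceBarrierEtaTower
import Summits.HubbardSuperconductivity.HubbardSuperconductivity.Theorems.LiebTwinNoOnsiteODLROLargeUCondensateBound
import Literature.MathematicalPhysics.QuantumLattice.HubbardGroundStateDoublonBound

/-!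
# Crux `NoOnsiteODLRO` (stmt-HubbardSuperconductivity-0933) — the pseudospin ceiling on the on-site pair
# structure factor

THE PSEUDOSPIN CEILING (crux-strategist by-product B3, `Cruxes/NoOnsiteODLRO/STRATEGY-CENSUS.md`, Transfer T2):
for the Hubbard torus `H = hubbardTorus 2 L 1 U` on `(ℤ/Lℤ)²` with `L` even, every ground state `ψ` of the
joint sector `(N, S^z = 0)`, `2 ≤ N ≤ L²`, satisfies

  `w · Re⟨ψ, P_sᴴ P_s ψ⟩ ≤ (L² - N + 2) · (-Re⟨ψ, T ψ⟩)`,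

where `P_s = pairField sWave L = -√2 η₁` is the on-site (`k = 0`) pair field, `T = hubbardTorus 2 L 1 0` the
hopping operator, and `w = U - (E(N,0) - E(N-2,0))` the pair window (`E(M,0) = minEnergyOn H (szSector M 0)`)
(`pseudospinOnsiteCeiling`; with `-Re⟨ψ,Tψ⟩ ≤ 4N‖ψ‖²`, `pseudospinOnsiteCeiling_filling`). For the crux's
admissible sequences (`N_L ≈ (1-δ)L²`) this is the closed-form every-ground-state density ceiling
`S_L / L⁴ ≤ 4δ(1-δ)/w_L + O(L⁻²)` — a ceiling, not the crux's `o(L⁴)`; it loses exactly the Clebsch–Gordan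
factor `L² - N + 2 ≈ δL²` by which a doped ground state is pseudospin-polarised.

Proof (Zhang's pseudospin `SU(2)` transported off half filling, with a polarization trick in place of
Wigner–Eckart). Nothing to prove if `w ≤ 0`. If `w > 0` the ground state is an `η`-vacuum, `ηψ = 0`
(`etaLower_groundState_eq_zero_of_window`). Let `N_A` be the particle number of the even sublattice
`A = {torusStagger = 1}` and `v := N_A ψ` (same sector as `ψ`). Charges: `[N_A, η] = -(η + η₁)`
(`numberDiag_sublattice_comm_etaLower`), so `η v = η₁ ψ =: y`, and `η y = η₁ η ψ = 0`; every hopping term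
has charge `±1` across the sublattice boundary, so the double commutator of `H` with `N_A` is `-T`
(`doubleComm_numberDiag_sublattice_hamiltonian`) and the `f`-sum rule reads
`2 Q(v) = -Re⟨ψ,Tψ⟩`, `Q(χ) := Re⟨χ,(H - E)χ⟩ ≥ 0` on the sector (`two_mul_re_form_eq_neg_re`). With
`u := η† y`, Yang's relation gives `(H - E) u = η† z`, `z := H y + (U - E) y`, hence
`Re⟨v,(H-E)u⟩ = Re⟨y,z⟩ =: B ≥ w‖y‖²` (variational principle in the sector `(N-2,0)`) and
`Q(u) = Re⟨ηη†y, z⟩ = K·B`, `K = L² - N + 2` (`ηη† y = η†η y + K y = K y`). Positivity of `Q` at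
`v - K⁻¹u` gives `B ≤ K·Q(v)`, i.e. `w‖y‖² ≤ K·Q(v) = K·(-Re⟨ψ,Tψ⟩)/2`, and `Re⟨ψ,P_sᴴP_sψ⟩ = 2‖y‖²`.

Sources: S. C. Zhang, PRL 65 (1990) 120 and C. N. Yang, S. C. Zhang, Mod. Phys. Lett. B 4 (1990) 759
(pseudospin `SU(2)`, `(P_sᴴ, P_s, ρ_Q)` as a pseudospin vector); C. N. Yang, PRL 63 (1989) 2144 (`η` pairing);
E. H. Lieb, PRL 62 (1989) 1201 (sectors); H. Tasaki, *Physics and Mathematics of Quantum Many-Body Systems*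
(2020) §2.1 (variational principle); T. Koma, H. Tasaki, J. Stat. Phys. 76 (1994) 745 (double-commutator
identity). The combination is in-house (crux census B3); every ingredient is an elementary tree lemma.
No definition is introduced (the sublattice number is written out as a `diagonal`).
-/

noncomputable section

-- the mandated namespace `Summit.<Summit>.<Problem>.Theorems` repeats `HubbardSuperconductivity`
-- (single-problem summit, D-0017), which the `dupNamespace` linter flags on every declaration
set_option linter.dupNamespace false

namespace Summit.HubbardSuperconductivity.HubbardSuperconductivity.Theorems.NoOnsiteODLRO.Pseudospin

open Matrix Finset
open Literature.Probability.LatticeModels Literature.MathematicalPhysics.QuantumLattice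
open Summit.HubbardSuperconductivity.EnslavedA1g
  (cardShift_apply_eq_smul isInSector_etaRaise_mulVec star_dotProduct_mulVec_eq_conjTranspose)
open scoped ComplexOrder

/-! ### The pseudospin ceiling -/

section Main

variable {L : ℕ} [NeZero L]

/-- `Re⟨ψ, P_sᴴ P_s ψ⟩ = 2 ‖η₁ ψ‖²` for the on-site pair field `P_s = pairField sWave L = -√2 η₁`,
`η₁ = etaLower 1`. Scalapino, Phys. Rep. 250 (1995) 329, §2; Yang, PRL 63 (1989) 2144. [folklore] -/
theorem re_expect_pairField_sWave_eq (ψ : Fock (Orb (FermionTorus 2 L))) :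
    (expect ((pairField sWave L)ᴴ * pairField sWave L) ψ).re =
      2 * (star (etaLower (fun _ : FermionTorus 2 L => (1 : ℤˣ)) *ᵥ ψ) ⬝ᵥ
        (etaLower (fun _ : FermionTorus 2 L => (1 : ℤˣ)) *ᵥ ψ)).re := by
  rw [PosSemidefTrace.expect_conjTranspose_mul,
    TwSeededEnsembleEquivalence.ExposedDensity.etaTower_pairField_sWave_eq, smul_mulVec, star_smul,
    smul_dotProduct, dotProduct_smul, smul_smul, smul_eq_mul]
  have h2 : star (-((Real.sqrt 2 : ℝ) : ℂ)) * (-((Real.sqrt 2 : ℝ) : ℂ)) = ((2 : ℝ) : ℂ) := by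
    rw [star_neg, Complex.star_def, Complex.conj_ofReal, neg_mul_neg, ← Complex.ofReal_mul,
      Real.mul_self_sqrt zero_le_two]
  rw [h2, Complex.re_ofReal_mul]

/-- **THE PSEUDOSPIN CEILING** (crux-strategist by-product B3 for `NoOnsiteODLRO`, Transfer T2). For the
Hubbard torus `H = hubbardTorus 2 L 1 U` with `L` even and every ground state `ψ` of the joint sector
`(N, S^z = 0)`, `2 ≤ N ≤ L²`:
`(U - (E(N,0) - E(N-2,0))) · Re⟨ψ, P_sᴴP_s ψ⟩ ≤ (L² - N + 2) · (-Re⟨ψ, T ψ⟩)`,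
`P_s = pairField sWave L`, `T = hubbardTorus 2 L 1 0`, `E(M,0) = minEnergyOn H (szSector M 0)`.
See the module docstring for the proof (η-vacuum, sublattice-number charges, `f`-sum rule, Yang's
relation and a polarization step). Zhang, PRL 65 (1990) 120; Yang–Zhang, Mod. Phys. Lett. B 4 (1990) 759;
Yang, PRL 63 (1989) 2144; Koma–Tasaki, J. Stat. Phys. 76 (1994) 745. [folklore] -/
theorem pseudospinOnsiteCeiling (hL : Even L) (U : ℝ) {N : ℕ} (hN : 2 ≤ N) (hNL : N ≤ L ^ 2)
    {ψ : Fock (Orb (FermionTorus 2 L))} (hψ : IsGroundStateInSector (hubbardTorus 2 L 1 U) N 0 ψ) :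
    (U - ((hubbardTorus 2 L 1 U).minEnergyOn (szSector N 0) -
        (hubbardTorus 2 L 1 U).minEnergyOn (szSector (N - 2) 0))) *
        (expect ((pairField sWave L)ᴴ * pairField sWave L) ψ).re ≤
      ((L : ℝ) ^ 2 - N + 2) * -(expect (hubbardTorus 2 L 1 0) ψ).re := by
  obtain ⟨hmem, hne, hHψ⟩ := hψ
  obtain ⟨n, rfl, hncard⟩ :=
    Summit.HubbardSuperconductivity.HubbardSuperconductivity.Theorems.WcbcsSlater.exists_eq_two_mul_of_mem_szSector_zero
      hmem hne
  obtain ⟨m, rfl⟩ : ∃ m, n = m + 1 := ⟨n - 1, by omega⟩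
  have h2m : 2 * (m + 1) - 2 = 2 * m := by omega
  rw [h2m]
  set H := hubbardTorus 2 L 1 U with hHdef
  set E : ℝ := H.minEnergyOn (szSector (2 * (m + 1)) 0) with hEdef
  set E' : ℝ := H.minEnergyOn (szSector (2 * m) 0) with hE'def
  have hcard : Fintype.card (FermionTorus 2 L) = L ^ 2 := card_fermionTorus 2 L
  -- the Clebsch–Gordan constant `K = L² - N + 2 > 0`
  set K : ℝ := (L : ℝ) ^ 2 - 2 * m with hKdef
  have hKpos : 0 < K := by
    have h : ((2 * (m + 1) : ℕ) : ℝ) ≤ ((L ^ 2 : ℕ) : ℝ) := by exact_mod_cast hNL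
    push_cast at h
    rw [hKdef]
    linarith
  have hKeq : (L : ℝ) ^ 2 - ((2 * (m + 1) : ℕ) : ℝ) + 2 = K := by
    rw [hKdef]
    push_cast
    ring
  rw [hKeq]
  -- sectors and variational principles
  have hψsec : IsInSector (m + 1) (m + 1) ψ := (mem_szSector_two_mul_zero_iff (m + 1) ψ).1 hmem
  have hm0 : m ≤ Fintype.card (FermionTorus 2 L) := by omega
  have hvarV : ∀ χ : Fock (Orb (FermionTorus 2 L)), IsInSector (m + 1) (m + 1) χ →
      E * (star χ ⬝ᵥ χ).re ≤ (star χ ⬝ᵥ (H *ᵥ χ)).re :=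
    fun χ hχ => (szSector_groundState (fermionTorusGraph 2 L) 1 U hncard).2 χ hχ
  have hvarV' : ∀ χ : Fock (Orb (FermionTorus 2 L)), IsInSector m m χ →
      E' * (star χ ⬝ᵥ χ).re ≤ (star χ ⬝ᵥ (H *ᵥ χ)).re :=
    fun χ hχ => (szSector_groundState (fermionTorusGraph 2 L) 1 U hm0).2 χ hχ
  -- the sublattice number `NA` and `v := NA ψ`
  set A : Finset (FermionTorus 2 L) := Finset.univ.filter fun x => torusStagger x = 1 with hAdef
  set NA : Matrix (Finset (Orb (FermionTorus 2 L))) (Finset (Orb (FermionTorus 2 L))) ℂ :=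
    diagonal (fun s : Finset (Orb (FermionTorus 2 L)) => (((s ∩ orbs A).card : ℕ) : ℂ)) with hNAdef
  set v : Fock (Orb (FermionTorus 2 L)) := NA *ᵥ ψ with hvdef
  have hvsec : IsInSector (m + 1) (m + 1) v := by
    intro s hs
    rw [hvdef, hNAdef, mulVec_diagonal, hψsec s hs, mul_zero]
  -- the `f`-sum rule: `2 Q(v) = -Re⟨ψ, T ψ⟩`
  set Q : ℝ := (star v ⬝ᵥ (H *ᵥ v)).re - E * (star v ⬝ᵥ v).re with hQdef
  have hD := doubleComm_numberDiag_sublattice_hamiltonian (fermionTorusGraph 2 L) torusStagger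
    (fun x y h => torusStagger_eq_neg_of_adj_holds hL h) 1 U
  have hfsum : 2 * Q = -(star ψ ⬝ᵥ (hubbardTorus 2 L 1 0 *ᵥ ψ)).re :=
    two_mul_re_form_eq_neg_re (LiebThm1.hamiltonian_isHermitian (fermionTorusGraph 2 L) 1 U)
      (isHermitian_numberDiag (orbs A)) hD hHψ
  have hQnn : 0 ≤ Q := by
    have := hvarV v hvsec
    rw [hQdef]
    linarith
  -- `S = 2 ‖y‖²`, `y = η₁ ψ`
  set y : Fock (Orb (FermionTorus 2 L)) := etaLower (fun _ : FermionTorus 2 L => (1 : ℤˣ)) *ᵥ ψ with hydef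
  have hS : (expect ((pairField sWave L)ᴴ * pairField sWave L) ψ).re = 2 * (star y ⬝ᵥ y).re :=
    re_expect_pairField_sWave_eq ψ
  have hynn : 0 ≤ (star y ⬝ᵥ y).re := (Complex.nonneg_iff.mp (dotProduct_star_self_nonneg _)).1
  have hexpT : (expect (hubbardTorus 2 L 1 0) ψ).re = (star ψ ⬝ᵥ (hubbardTorus 2 L 1 0 *ᵥ ψ)).re := rfl
  rw [hS, hexpT]
  -- trivial case: closed window
  by_cases hw : U - (E - E') ≤ 0
  · have h1 : (U - (E - E')) * (2 * (star y ⬝ᵥ y).re) ≤ 0 :=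
      mul_nonpos_of_nonpos_of_nonneg hw (by positivity)
    have h2 : 0 ≤ K * -(star ψ ⬝ᵥ (hubbardTorus 2 L 1 0 *ᵥ ψ)).re :=
      mul_nonneg hKpos.le (by linarith)
    linarith
  push Not at hw
  -- strict window: `ψ` is an `η`-vacuum
  have hηψ : etaLower torusStagger *ᵥ ψ = 0 :=
    etaLower_groundState_eq_zero_of_window hL U (N := 2 * (m + 1)) (by omega) ⟨hmem, hne, hHψ⟩
      (by rwa [h2m])
  -- `η v = y`
  have hyv : etaLower torusStagger *ᵥ v = y := by
    have hc := numberDiag_sublattice_comm_etaLower (Λ := FermionTorus 2 L) torusStagger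
    rw [← hAdef, ← hNAdef] at hc
    have h1 : etaLower torusStagger * NA =
        NA * etaLower torusStagger + (etaLower torusStagger + etaLower fun _ => 1) := by
      calc etaLower torusStagger * NA
          = NA * etaLower torusStagger - (NA * etaLower torusStagger - etaLower torusStagger * NA) := by
            abel
        _ = NA * etaLower torusStagger + (etaLower torusStagger + etaLower fun _ => 1) := by
            rw [hc, sub_neg_eq_add]
    rw [hvdef, mulVec_mulVec, h1, add_mulVec, add_mulVec, ← mulVec_mulVec, hηψ, mulVec_zero, zero_add,
      zero_add]
  -- `η y = 0`
  have hηy : etaLower torusStagger *ᵥ y = 0 := by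
    rw [hydef, mulVec_mulVec, etaLower_mul_etaLower_comm, ← mulVec_mulVec, hηψ, mulVec_zero]
  -- `y ∈ (m, m)`, `u := η† y ∈ (m+1, m+1)`, `η u = K y`
  have hysec : IsInSector m m y := by
    rw [← hyv]
    exact isInSector_etaLower_mulVec hvsec _
  set u : Fock (Orb (FermionTorus 2 L)) := etaRaise torusStagger *ᵥ y with hudef
  have husec : IsInSector (m + 1) (m + 1) u := isInSector_etaRaise_mulVec hysec _
  have hηu : etaLower torusStagger *ᵥ u = (K : ℂ) • y := by
    rw [hudef, EtaPairingODLRO.etaLower_mulVec_etaRaise_mulVec, hηy, mulVec_zero, zero_add,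
      cardShift_apply_eq_smul hysec.isNParticle, hcard]
    congr 1
    rw [hKdef]
    push_cast
    ring
  -- Yang: `H u = η† z + E u` with `z := H y + (U - E) y`
  set z : Fock (Orb (FermionTorus 2 L)) := H *ᵥ y + ((U - E : ℝ) : ℂ) • y with hzdef
  have hcommR : H * etaRaise torusStagger =
      etaRaise torusStagger * H + (U : ℂ) • etaRaise torusStagger := by
    have h := etaRaise_commutator_holds (d := 2) (L := L) hL 1 U 0
    rw [hubbardTorusWith_zero, mul_zero, sub_zero] at h
    rw [← h]
    abel
  have hHu : H *ᵥ u = etaRaise torusStagger *ᵥ z + (E : ℂ) • u := by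
    rw [hudef, mulVec_mulVec, hcommR, add_mulVec, smul_mulVec, ← mulVec_mulVec, hzdef, mulVec_add,
      mulVec_smul, Complex.ofReal_sub, sub_smul]
    abel
  -- the shifted form `Kmat = H - E`
  set Kmat : Matrix (Finset (Orb (FermionTorus 2 L))) (Finset (Orb (FermionTorus 2 L))) ℂ :=
    H - (E : ℂ) • (1 : Matrix _ _ ℂ) with hKmatdef
  have hHherm : Hᴴ = H := (LiebThm1.hamiltonian_isHermitian (fermionTorusGraph 2 L) 1 U).eq
  have hKmat : Kmat.IsHermitian := by
    change Kmatᴴ = Kmat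
    rw [hKmatdef, conjTranspose_sub, conjTranspose_smul, conjTranspose_one, hHherm, Complex.star_def,
      Complex.conj_ofReal]
  have hKv : ∀ χ : Fock (Orb (FermionTorus 2 L)), Kmat *ᵥ χ = H *ᵥ χ - (E : ℂ) • χ := by
    intro χ
    rw [hKmatdef, sub_mulVec, smul_mulVec, one_mulVec]
  have hform : ∀ χ : Fock (Orb (FermionTorus 2 L)),
      (star χ ⬝ᵥ (Kmat *ᵥ χ)).re = (star χ ⬝ᵥ (H *ᵥ χ)).re - E * (star χ ⬝ᵥ χ).re := by
    intro χ
    rw [hKv, dotProduct_sub, dotProduct_smul, smul_eq_mul, Complex.sub_re, Complex.re_ofReal_mul]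
  have hpsd : ∀ χ : Fock (Orb (FermionTorus 2 L)), IsInSector (m + 1) (m + 1) χ →
      0 ≤ (star χ ⬝ᵥ (Kmat *ᵥ χ)).re := by
    intro χ hχ
    rw [hform]
    have := hvarV χ hχ
    linarith
  -- `Kmat u = η† z`, `⟨v, Kmat u⟩ = ⟨y, z⟩`, `⟨u, Kmat u⟩ = K ⟨y, z⟩`
  have hKu : Kmat *ᵥ u = etaRaise torusStagger *ᵥ z := by
    rw [hKv, hHu, add_sub_cancel_right]
  have hadj : ∀ χ : Fock (Orb (FermionTorus 2 L)),
      star χ ⬝ᵥ (etaRaise torusStagger *ᵥ z) = star (etaLower torusStagger *ᵥ χ) ⬝ᵥ z := by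
    intro χ
    rw [star_dotProduct_mulVec_eq_conjTranspose]
    rfl
  have hvu : star v ⬝ᵥ (Kmat *ᵥ u) = star y ⬝ᵥ z := by
    rw [hKu, hadj, hyv]
  have huu : star u ⬝ᵥ (Kmat *ᵥ u) = (K : ℂ) * (star y ⬝ᵥ z) := by
    rw [hKu, hadj, hηu, star_smul, smul_dotProduct, smul_eq_mul, Complex.star_def, Complex.conj_ofReal]
  -- `B := Re⟨y, z⟩ ≥ w ‖y‖²`
  set B : ℝ := (star y ⬝ᵥ z).re with hBdef
  have hB : (U - (E - E')) * (star y ⬝ᵥ y).re ≤ B := by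
    rw [hBdef, hzdef, dotProduct_add, dotProduct_smul, Complex.add_re, smul_eq_mul, Complex.re_ofReal_mul]
    have := hvarV' y hysec
    nlinarith
  -- polarization: `0 ≤ Q(v - K⁻¹ u) = Q - B/K`
  have key : B ≤ K * Q := by
    have hχsec : IsInSector (m + 1) (m + 1) (v - ((1 / K : ℝ) : ℂ) • u) := hvsec.sub (husec.smul _)
    have h0 := hpsd _ hχsec
    rw [tian_re_form_sub_smul hKmat v u (1 / K), huu, hvu, hform v, ← hQdef, ← hBdef,
      Complex.re_ofReal_mul, ← hBdef] at h0
    have h1 : K * B * (1 / K * (1 / K)) + -(2 * B) * (1 / K) + Q = Q - B / K := by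
      field_simp
      ring
    rw [h1] at h0
    rw [← sub_nonneg]
    have h3 : K * Q - B = K * (Q - B / K) := by
      field_simp
    rw [h3]
    exact mul_nonneg hKpos.le h0
  -- conclude: `w · 2‖y‖² ≤ 2B ≤ 2KQ = K · (-Re⟨ψ,Tψ⟩)`
  calc (U - (E - E')) * (2 * (star y ⬝ᵥ y).re)
      = 2 * ((U - (E - E')) * (star y ⬝ᵥ y).re) := by ring
    _ ≤ 2 * (K * Q) := by linarith [hB, key]
    _ = K * -(star ψ ⬝ᵥ (hubbardTorus 2 L 1 0 *ᵥ ψ)).re := by rw [← hfsum]; ring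

/-- **Pseudospin ceiling, filling form.** With the free band bound `-Re⟨ψ, Tψ⟩ ≤ 4N‖ψ‖²`
(`re_expect_hubbardTorus_zero_ge`, `L ≥ 3`): for `L` even, `L ≥ 3`, and every ground state `ψ` of the
sector `(N, S^z = 0)`, `2 ≤ N ≤ L²`,
`(U - (E(N,0) - E(N-2,0))) · Re⟨ψ, P_sᴴP_s ψ⟩ ≤ (L² - N + 2) · 4N · ‖ψ‖²`.
At filling `N ≈ (1-δ)L²` the right side is `≈ 4δ(1-δ) L⁴ ‖ψ‖²` (crux census B3:
`S_L/L⁴ ≤ 4δ(1-δ)/w_L + O(L⁻²)`). Zhang, PRL 65 (1990) 120; Yang, PRL 63 (1989) 2144. [folklore] -/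
theorem pseudospinOnsiteCeiling_filling (hL : Even L) (h3 : 3 ≤ L) (U : ℝ) {N : ℕ} (hN : 2 ≤ N)
    (hNL : N ≤ L ^ 2) {ψ : Fock (Orb (FermionTorus 2 L))}
    (hψ : IsGroundStateInSector (hubbardTorus 2 L 1 U) N 0 ψ) :
    (U - ((hubbardTorus 2 L 1 U).minEnergyOn (szSector N 0) -
        (hubbardTorus 2 L 1 U).minEnergyOn (szSector (N - 2) 0))) *
        (expect ((pairField sWave L)ᴴ * pairField sWave L) ψ).re ≤
      ((L : ℝ) ^ 2 - N + 2) * (4 * N) * (star ψ ⬝ᵥ ψ).re := by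
  have h := pseudospinOnsiteCeiling hL U hN hNL hψ
  obtain ⟨hmem, hne, -⟩ := hψ
  obtain ⟨n, rfl, -⟩ :=
    Summit.HubbardSuperconductivity.HubbardSuperconductivity.Theorems.WcbcsSlater.exists_eq_two_mul_of_mem_szSector_zero
      hmem hne
  have hsec : IsInSector n n ψ := (mem_szSector_two_mul_zero_iff n ψ).1 hmem
  have hT := re_expect_hubbardTorus_zero_ge L h3 hsec
  have hK : 0 ≤ (L : ℝ) ^ 2 - ((2 * n : ℕ) : ℝ) + 2 := by
    have h1 : ((2 * n : ℕ) : ℝ) ≤ ((L ^ 2 : ℕ) : ℝ) := by exact_mod_cast hNL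
    push_cast at h1 ⊢
    linarith
  have hexpT : (expect (hubbardTorus 2 L 1 0) ψ).re = (star ψ ⬝ᵥ (hubbardTorus 2 L 1 0 *ᵥ ψ)).re := rfl
  refine h.trans ?_
  rw [mul_assoc]
  refine mul_le_mul_of_nonneg_left ?_ hK
  rw [hexpT]
  push_cast at hT ⊢
  linarith

/-- **Large-`U` on-site density ceiling, pseudospin form** (complements the `O(U⁻²)` bound
`LargeU.onsiteCondensate_le_largeU`). For `0 < δ`, `144/√δ < U`, even `L > 2`, hole density `≥ δ`
(`2m + 1 + δL² ≤ L²`) and every ground state `ψ` of `hubbardTorus 2 L 1 U` in the sector `(2m+2, 0)`: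
`Re⟨ψ, P_sᴴP_s ψ⟩ ≤ (L² - 2m) · 4(2m+2) · ‖ψ‖² / (U - 144/√δ)` — the strict window `w_L ≥ U - 144/√δ`
(`LargeU.pairWindow_ge_largeU`) fed into the pseudospin ceiling. Along the crux's admissible sequences
this reads `S_L/L⁴ ≤ 4δ(1-δ)/(U - 144/√δ) + O(L⁻²)`, sharper than `128/(U - 144/√δ)²` whenever
`U - 144/√δ < 32/(δ(1-δ))`; still a ceiling, not the crux's `o(L⁴)`. Zhang, PRL 65 (1990) 120;
Kubo–Kishi, PRB 41 (1990) 4866 (half filling). [folklore] -/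
theorem onsiteCondensate_le_largeU_pseudospin {U δ : ℝ} (hδ : 0 < δ) (hU : 144 / Real.sqrt δ < U)
    (hLe : Even L) (hL : 2 < L) {m : ℕ} (hm : (2 * (m : ℝ) + 1) + δ * (L : ℝ) ^ 2 ≤ (L : ℝ) ^ 2)
    {ψ : Fock (Orb (FermionTorus 2 L))} (hGS : IsGroundStateInSector (hubbardTorus 2 L 1 U) (2 * m + 2) 0 ψ) :
    (expect ((pairField sWave L)ᴴ * pairField sWave L) ψ).re ≤
      ((L : ℝ) ^ 2 - 2 * m) * (4 * (2 * m + 2)) * (star ψ ⬝ᵥ ψ).re / (U - 144 / Real.sqrt δ) := by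
  have hLpos : (0 : ℝ) < (L : ℝ) := by exact_mod_cast Nat.pos_of_ne_zero (NeZero.ne L)
  have hδL : 0 < δ * (L : ℝ) ^ 2 := by positivity
  have hmL : 2 * m + 2 ≤ L ^ 2 := by
    have h1 : (2 * (m : ℝ) + 1) < (L : ℝ) ^ 2 := by linarith
    have h2 : ((2 * m + 1 : ℕ) : ℝ) < ((L ^ 2 : ℕ) : ℝ) := by push_cast; exact h1
    have h3 : 2 * m + 1 < L ^ 2 := by exact_mod_cast h2
    omega
  have h := pseudospinOnsiteCeiling_filling hLe (by omega) U (N := 2 * m + 2) (by omega) hmL hGS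
  have h2m : 2 * m + 2 - 2 = 2 * m := by omega
  rw [h2m] at h
  set κ : ℝ := U - ((hubbardTorus 2 L 1 U).minEnergyOn (szSector (2 * m + 2) 0) -
    (hubbardTorus 2 L 1 U).minEnergyOn (szSector (2 * m) 0)) with hκdef
  set S : ℝ := (expect ((pairField sWave L)ᴴ * pairField sWave L) ψ).re with hS
  have hκge : U - 144 / Real.sqrt δ ≤ κ :=
    Summit.HubbardSuperconductivity.NoOnsiteODLRO.LargeU.pairWindow_ge_largeU L U hδ hm
  have hκ₀pos : 0 < U - 144 / Real.sqrt δ := by linarith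
  have hSnn : 0 ≤ S := by
    rw [hS, PosSemidefTrace.expect_conjTranspose_mul]
    exact (Complex.nonneg_iff.mp (dotProduct_star_self_nonneg _)).1
  rw [le_div_iff₀ hκ₀pos]
  have hcast : ((L : ℝ) ^ 2 - ((2 * m + 2 : ℕ) : ℝ) + 2) * (4 * ((2 * m + 2 : ℕ) : ℝ)) =
      ((L : ℝ) ^ 2 - 2 * m) * (4 * (2 * m + 2)) := by
    push_cast
    ring
  calc S * (U - 144 / Real.sqrt δ) ≤ S * κ := mul_le_mul_of_nonneg_left hκge hSnn
    _ = κ * S := mul_comm _ _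
    _ ≤ ((L : ℝ) ^ 2 - ((2 * m + 2 : ℕ) : ℝ) + 2) * (4 * ((2 * m + 2 : ℕ) : ℝ)) * (star ψ ⬝ᵥ ψ).re := h
    _ = ((L : ℝ) ^ 2 - 2 * m) * (4 * (2 * m + 2)) * (star ψ ⬝ᵥ ψ).re := by rw [hcast]

/-- **Registered stub `stub_pseudospinOnsiteCeiling`** of crux `NoOnsiteODLRO`
(stmt-HubbardSuperconductivity-0933; crux-strategist by-product B3, not a piece of a line composition):
the pseudospin ceiling `pseudospinOnsiteCeiling`, fully quantified. Zhang, PRL 65 (1990) 120;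
Yang–Zhang, Mod. Phys. Lett. B 4 (1990) 759; Koma–Tasaki, J. Stat. Phys. 76 (1994) 745. [folklore] -/
theorem stub_pseudospinOnsiteCeiling :
    ∀ (L : ℕ) [NeZero L], Even L → ∀ (U : ℝ) (N : ℕ) (ψ : Fock (Orb (FermionTorus 2 L))), 2 ≤ N →
      N ≤ L ^ 2 → IsGroundStateInSector (hubbardTorus 2 L 1 U) N 0 ψ →
        (U - ((hubbardTorus 2 L 1 U).minEnergyOn (szSector (Λ := FermionTorus 2 L) N 0) -
            (hubbardTorus 2 L 1 U).minEnergyOn (szSector (Λ := FermionTorus 2 L) (N - 2) 0))) *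
            (expect ((pairField sWave L)ᴴ * pairField sWave L) ψ).re ≤
          ((L : ℝ) ^ 2 - N + 2) * -(expect (hubbardTorus 2 L 1 0) ψ).re :=
  fun _ _ hL U _ _ hN hNL hψ => pseudospinOnsiteCeiling hL U hN hNL hψ

end Main

end Summit.HubbardSuperconductivity.HubbardSuperconductivity.Theorems.NoOnsiteODLRO.Pseudospin

end
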